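import Literature.Analysis.SpecialFunctions.DigammaLogBound
import Mathlib.Analysis.SpecialFunctions.Gamma.Digamma
import Mathlib.Analysis.SpecialFunctions.Gamma.Deriv
import Mathlib.Analysis.SpecialFunctions.Complex.LogDeriv
import Mathlib.Analysis.SpecialFunctions.Integrals.Basic
import Mathlib.MeasureTheory.Integral.IntervalIntegral.FundThmCalculus
import Mathlib.Analysis.Calculus.MeanValue
import Mathlib.Analysis.Complex.RealDeriv
import HarnessLib

/-!
# First-order Stirling for `ψ` off the real axis, and the second-order expansion of `Γ(w₀+d)/Γ(w₀)`

Topic: `Literature/Analysis/SpecialFunctions` (companion of `DigammaGauss.lean`,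
`DigammaLogBound.lean`). Everything here is proved; no named facts.

## Main results

* `Literature.Analysis.SpecialFunctions.Complex.arg_le_im_digamma` — for `Re u > 0`, `Im u > 0`:
  `Arg u ≤ Im ψ(u) ≤ Arg u + Im u/‖u‖²` (sum–integral comparison for
  `Im ψ(u) = Σ_k Im u/‖u+k‖²`, `Literature.Analysis.SpecialFunctions.Complex.hasSum_im_digamma`, against
  `∫_0^∞ b dx/((a+x)²+b²) = π/2 − arctan(a/b) = Arg(a+ib)`).
* `Literature.Analysis.SpecialFunctions.Complex.norm_digamma_sub_log_le` — `‖ψ(u) − Log u‖ ≤ 1/(2‖u‖²) + π/(4 Im u) + Im u/‖u‖²` on the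
  open first quadrant (real part from `Literature.Analysis.SpecialFunctions.Complex.abs_re_digamma_sub_log_norm_le`).
* `Literature.Analysis.SpecialFunctions.Complex.norm_digamma_sub_log_le_of_im_pos` — for `Im u > 0` and `Re u + m > 0`:
  `‖ψ(u) − Log u‖ ≤ (π/4+1)/Im u + (m+1)/(Im u)²` (recurrence `ψ(u+1) = ψ(u) + 1/u` telescoped
  against `Log`, each step costing `≤ 1/(Im u)²`).
* `Literature.Analysis.SpecialFunctions.Complex.Gamma_eq_mul_exp_integral_digamma` — `Γ(w) = Γ(w₀) exp(∫_{[w₀,w]} ψ)` for `w₀, w` in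
  the open upper half-plane.
* `Literature.Analysis.SpecialFunctions.Complex.Gamma_eq_mul_exp_taylor` — if moreover `‖d‖ ≤ ‖w₀‖/2` and `‖ψ − Log‖ ≤ ε` on
  `[w₀, w₀+d]`, then `Γ(w₀+d) = Γ(w₀) exp(Log(w₀) d + d²/(2w₀) + E)` with
  `‖E‖ ≤ ε‖d‖ + 2‖d‖³/‖w₀‖²` — the one-`Γ`-factor core of [Dobner2021, Lemma 5]
  (there via Stirling's formula in sectors; here via `ψ`).

## References

* [Dobner2021] A. Dobner, *A proof of Newman's conjecture for the extended Selberg class*,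
  Acta Arith. 201 (2021), 29–62, Lemma 5 (arXiv:2005.05142, p. 11 and pp. 16–17).
-/

noncomputable section

open Complex Filter Topology Set Finset MeasureTheory intervalIntegral

namespace Literature.Analysis.SpecialFunctions.Complex

/-! ## `Im ψ(u)` versus `Arg u` on the open first quadrant -/

/-- The comparison function `f(x) = b/((a+x)² + b²)` is antitone on `x ≥ 0` when `a ≥ 0`. [folklore] -/
theorem antitoneOn_im_kernel {a b : ℝ} (ha : 0 ≤ a) (hb : 0 ≤ b) :
    AntitoneOn (fun x : ℝ ↦ b / ((a + x) ^ 2 + b ^ 2)) (Ici 0) := by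
  intro x hx y hy hxy
  simp only [Set.mem_Ici] at hx hy
  have h1 : 0 < (a + x) ^ 2 + b ^ 2 ∨ ((a + x) ^ 2 + b ^ 2 = 0) := by
    rcases (add_nonneg (sq_nonneg (a + x)) (sq_nonneg b)).lt_or_eq with h | h
    · exact Or.inl h
    · exact Or.inr h.symm
  rcases h1 with h1 | h1
  · refine div_le_div_of_nonneg_left hb h1 ?_
    nlinarith
  · have hb0 : b = 0 := by nlinarith [sq_nonneg (a + x), sq_nonneg b]
    simp [hb0]

/-- `∫_0^N b dx/((a+x)² + b²) = arctan((a+N)/b) − arctan(a/b)` for `b > 0`. [folklore] -/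
theorem integral_im_kernel {a b : ℝ} (hb : 0 < b) (N : ℝ) :
    ∫ x in (0 : ℝ)..N, b / ((a + x) ^ 2 + b ^ 2) = Real.arctan ((a + N) / b) - Real.arctan (a / b) := by
  have hderiv : ∀ x : ℝ, HasDerivAt (fun x : ℝ ↦ Real.arctan ((a + x) / b)) (b / ((a + x) ^ 2 + b ^ 2)) x := by
    intro x
    have h1 : HasDerivAt (fun x : ℝ ↦ (a + x) / b) (1 / b) x := by
      have := ((hasDerivAt_id x).const_add a).div_const b
      simpa using this
    have h2 := (Real.hasDerivAt_arctan ((a + x) / b)).comp x h1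
    have h3 : 1 / (1 + ((a + x) / b) ^ 2) * (1 / b) = b / ((a + x) ^ 2 + b ^ 2) := by
      have : (a + x) ^ 2 + b ^ 2 ≠ 0 := by positivity
      field_simp
      ring
    rw [h3] at h2
    exact h2
  have hcont : Continuous fun x : ℝ ↦ b / ((a + x) ^ 2 + b ^ 2) := by
    refine Continuous.div continuous_const (by fun_prop) fun x ↦ ?_
    positivity
  rw [intervalIntegral.integral_eq_sub_of_hasDerivAt (fun x _ ↦ hderiv x) (hcont.intervalIntegrable _ _)]
  simp

/-- **Two-sided comparison of `Im ψ` with `Arg`**: for `Re u > 0`, `Im u > 0`,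
`Arg u ≤ Im ψ(u) ≤ Arg u + Im u/‖u‖²` (sum–integral comparison for the series
`Im ψ(u) = Im u · Σ_k ‖u+k‖⁻²` of `DigammaLogBound.lean`, and `∫_0^∞ b dx/((a+x)²+b²) = π/2 − arctan(a/b) = Arg(a+ib)`).
[folklore] -/
theorem arg_le_im_digamma {u : ℂ} (ha : 0 < u.re) (hb : 0 < u.im) :
    Complex.arg u ≤ (digamma u).im ∧ (digamma u).im ≤ Complex.arg u + u.im / ‖u‖ ^ 2 := by
  set a : ℝ := u.re with hadef
  set b : ℝ := u.im with hbdef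
  set f : ℝ → ℝ := fun x ↦ b / ((a + x) ^ 2 + b ^ 2) with hf
  -- the series
  have hsum : HasSum (fun k : ℕ ↦ f k) (digamma u).im := by
    have h := hasSum_im_digamma ha
    refine h.congr_fun fun k ↦ ?_
    simp only [hf]
    congr 1
    rw [Complex.sq_norm, Complex.normSq_apply]
    simp [hadef, hbdef]
    ring
  have hlim_sum : Tendsto (fun N : ℕ ↦ ∑ k ∈ Finset.range N, f k) atTop (𝓝 (digamma u).im) :=
    hsum.tendsto_sum_nat
  -- the integrals
  have hint : ∀ N : ℕ, ∫ x in (0 : ℝ)..N, f x = Real.arctan ((a + N) / b) - Real.arctan (a / b) :=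
    fun N ↦ integral_im_kernel hb N
  have hlim_int : Tendsto (fun N : ℕ ↦ ∫ x in (0 : ℝ)..N, f x) atTop
      (𝓝 (Real.pi / 2 - Real.arctan (a / b))) := by
    simp_rw [hint]
    refine Tendsto.sub_const ?_ _
    have h1 : Tendsto (fun N : ℕ ↦ (a + N) / b) atTop atTop :=
      Tendsto.atTop_div_const hb (tendsto_atTop_add_const_left _ _ tendsto_natCast_atTop_atTop)
    exact (Real.tendsto_arctan_atTop.mono_right nhdsWithin_le_nhds).comp h1
  -- sum–integral comparison
  have hanti : ∀ N : ℕ, AntitoneOn f (Icc (0 : ℝ) (0 + N)) := fun N ↦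
    (antitoneOn_im_kernel ha.le hb.le).mono (fun x hx ↦ hx.1)
  have hlow : ∀ N : ℕ, ∫ x in (0 : ℝ)..N, f x ≤ ∑ k ∈ Finset.range N, f k := by
    intro N
    have := (hanti N).integral_le_sum
    simpa using this
  have hup : ∀ N : ℕ, ∑ k ∈ Finset.range (N + 1), f k ≤ f 0 + ∫ x in (0 : ℝ)..N, f x := by
    intro N
    have := (hanti N).sum_le_integral
    simp only [zero_add] at this
    rw [Finset.sum_range_succ']
    push_cast
    linarith [Finset.sum_congr rfl (fun (k : ℕ) (_ : k ∈ Finset.range N) ↦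
      (congrArg f (Nat.cast_succ k) : f ((k + 1 : ℕ) : ℝ) = f ((k : ℝ) + 1)))]
  -- `Arg u = π/2 − arctan(a/b)`
  have harg : Complex.arg u = Real.pi / 2 - Real.arctan (a / b) := by
    rw [← Real.arctan_inv_of_pos (div_pos ha hb), inv_div, Real.arctan_eq_arcsin,
      Complex.arg_of_re_nonneg ha.le]
    congr 1
    have hn : ‖u‖ = Real.sqrt (a ^ 2 + b ^ 2) := by
      rw [Complex.norm_eq_sqrt_sq_add_sq]
    rw [hn]
    have hsq : Real.sqrt (1 + (b / a) ^ 2) = Real.sqrt (a ^ 2 + b ^ 2) / a := by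
      rw [show (1 : ℝ) + (b / a) ^ 2 = (a ^ 2 + b ^ 2) / a ^ 2 by field_simp, Real.sqrt_div' _ (sq_nonneg a),
        Real.sqrt_sq ha.le]
    rw [hsq]
    field_simp
    rfl
  -- pass to the limit
  constructor
  · rw [harg]
    refine le_of_tendsto_of_tendsto hlim_int hlim_sum (Eventually.of_forall hlow)
  · rw [harg]
    have hlim_sum' : Tendsto (fun N : ℕ ↦ ∑ k ∈ Finset.range (N + 1), f k) atTop (𝓝 (digamma u).im) :=
      hlim_sum.comp (tendsto_add_atTop_nat 1)
    have hlim_rhs : Tendsto (fun N : ℕ ↦ f 0 + ∫ x in (0 : ℝ)..N, f x) atTop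
        (𝓝 (f 0 + (Real.pi / 2 - Real.arctan (a / b)))) := hlim_int.const_add _
    have h := le_of_tendsto_of_tendsto hlim_sum' hlim_rhs (Eventually.of_forall hup)
    have hf0 : f 0 = b / ‖u‖ ^ 2 := by
      simp only [hf, add_zero]
      rw [Complex.sq_norm, Complex.normSq_apply]; simp [hadef, hbdef]; ring
    linarith

/-- **First-order Stirling for the digamma function in the open first quadrant**:
`‖ψ(u) − Log u‖ ≤ 1/(2‖u‖²) + π/(4 Im u) + Im u/‖u‖²` for `Re u > 0`, `Im u > 0`
(real part: `DigammaGauss.lean`; imaginary part: `arg_le_im_digamma`). [folklore] -/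
theorem norm_digamma_sub_log_le {u : ℂ} (ha : 0 < u.re) (hb : 0 < u.im) :
    ‖digamma u - Complex.log u‖ ≤ 1 / (2 * ‖u‖ ^ 2) + Real.pi / (4 * |u.im|) + u.im / ‖u‖ ^ 2 := by
  have hre := abs_re_digamma_sub_log_norm_le ha hb.ne'
  obtain ⟨h1, h2⟩ := arg_le_im_digamma ha hb
  have him : |(digamma u - Complex.log u).im| ≤ u.im / ‖u‖ ^ 2 := by
    rw [Complex.sub_im, Complex.log_im, abs_le]
    constructor <;> linarith [div_nonneg hb.le (sq_nonneg ‖u‖)]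
  have hre' : |(digamma u - Complex.log u).re| ≤ 1 / (2 * ‖u‖ ^ 2) + Real.pi / (4 * |u.im|) := by
    rw [Complex.sub_re, Complex.log_re]
    exact hre
  calc ‖digamma u - Complex.log u‖ ≤ |(digamma u - Complex.log u).re| + |(digamma u - Complex.log u).im| :=
        Complex.norm_le_abs_re_add_abs_im _
    _ ≤ _ := add_le_add hre' him


/-! ## Extension to the left of the imaginary axis via the recurrence -/

/-- `‖Log(v+1) − Log v − 1/v‖ ≤ 1/(Im v)²` for `Im v > 0`. [folklore] -/
theorem norm_log_add_one_sub_log_sub_inv_le {v : ℂ} (hv : 0 < v.im) :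
    ‖Complex.log (v + 1) - Complex.log v - v⁻¹‖ ≤ 1 / v.im ^ 2 := by
  have hslit : ∀ x : ℝ, v + x ∈ slitPlane := fun x ↦ by
    rw [Complex.mem_slitPlane_iff]; right; simpa using hv.ne'
  have hvx : ∀ x : ℝ, v + x ≠ 0 := fun x h ↦ by simpa [h] using hslit x
  have hv0 : v ≠ 0 := by simpa using hvx 0
  have hderiv : ∀ x : ℝ, HasDerivAt (fun x : ℝ ↦ Complex.log (v + x) - x * v⁻¹)
      ((v + x)⁻¹ - v⁻¹) x := by
    intro x
    have h2 : HasDerivAt (fun x : ℝ ↦ Complex.log (v + x)) ((v + x)⁻¹) x := by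
      have h1 := ((Complex.hasDerivAt_log (hslit x)).comp (x : ℂ)
        ((hasDerivAt_id (x : ℂ)).const_add v)).comp_ofReal
      simpa using h1
    have h3 : HasDerivAt (fun x : ℝ ↦ (x : ℂ) * v⁻¹) v⁻¹ x := by
      simpa using (Complex.ofRealCLM.hasDerivAt (x := x)).mul_const v⁻¹
    exact h2.sub h3
  have hcont : Continuous fun x : ℝ ↦ (v + x)⁻¹ - v⁻¹ :=
    ((continuous_const.add Complex.continuous_ofReal).inv₀ hvx).sub continuous_const
  have hint := intervalIntegral.integral_eq_sub_of_hasDerivAt (a := 0) (b := 1)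
    (fun x _ ↦ hderiv x) (hcont.intervalIntegrable _ _)
  have heq : Complex.log (v + 1) - Complex.log v - v⁻¹ = ∫ x in (0:ℝ)..1, ((v + x)⁻¹ - v⁻¹) := by
    rw [hint]; simp; ring
  rw [heq]
  have hb : ∀ x ∈ Set.uIoc (0:ℝ) 1, ‖(v + x)⁻¹ - v⁻¹‖ ≤ 1 / v.im ^ 2 := by
    intro x hx
    rw [Set.uIoc_of_le zero_le_one, Set.mem_Ioc] at hx
    have hvx' := hvx x
    rw [show (v + x)⁻¹ - v⁻¹ = -(x : ℂ) / (v * (v + x)) by field_simp; ring]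
    rw [norm_div, norm_neg, norm_mul, Complex.norm_real, Real.norm_eq_abs, abs_of_pos hx.1]
    have h1 : v.im ≤ ‖v‖ := le_trans (le_abs_self _) (Complex.abs_im_le_norm v)
    have h2 : v.im ≤ ‖v + x‖ := by
      have : (v + x).im = v.im := by simp
      rw [← this]; exact le_trans (le_abs_self _) (Complex.abs_im_le_norm _)
    have hprod : v.im * v.im ≤ ‖v‖ * ‖v + x‖ := mul_le_mul h1 h2 hv.le (norm_nonneg _)
    calc x / (‖v‖ * ‖v + ↑x‖) ≤ 1 / (v.im * v.im) := div_le_div₀ zero_le_one hx.2 (mul_pos hv hv) hprod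
      _ = 1 / v.im ^ 2 := by rw [sq]
  calc ‖∫ x in (0:ℝ)..1, ((v + x)⁻¹ - v⁻¹)‖ ≤ 1 / v.im ^ 2 * |1 - 0| :=
        intervalIntegral.norm_integral_le_of_norm_le_const hb
    _ = 1 / v.im ^ 2 := by simp

/-- The recurrence `ψ(u+1) = ψ(u) + 1/u` telescoped against `Log`: for `Im u > 0`,
`ψ(u+m) − Log(u+m) = ψ(u) − Log u + Σ_{j<m} (1/(u+j) − (Log(u+j+1) − Log(u+j)))`. [folklore] -/
theorem digamma_sub_log_add_nat {u : ℂ} (hu : 0 < u.im) (m : ℕ) :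
    digamma (u + m) - Complex.log (u + m) = digamma u - Complex.log u +
      ∑ j ∈ Finset.range m, ((u + j)⁻¹ - (Complex.log (u + j + 1) - Complex.log (u + j))) := by
  induction m with
  | zero => simp
  | succ m ih =>
    rw [Finset.sum_range_succ, ← add_assoc, ← ih]
    have hne : ∀ k : ℕ, u + m ≠ -k := by
      intro k h
      have := congrArg Complex.im h
      simp at this
      exact hu.ne' this
    have hrec := Complex.digamma_apply_add_one (u + m) hne
    push_cast
    rw [← add_assoc, hrec]
    ring

/-- **First-order Stirling for `ψ` in the upper half-plane**: for `Im u > 0` and `m : ℕ` with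
`Re u + m > 0`, `‖ψ(u) − Log u‖ ≤ (π/4 + 1)/Im u + (m + 1)/(Im u)²`. [folklore] -/
theorem norm_digamma_sub_log_le_of_im_pos {u : ℂ} (hu : 0 < u.im) (m : ℕ) (hm : 0 < u.re + m) :
    ‖digamma u - Complex.log u‖ ≤ (Real.pi / 4 + 1) / u.im + (m + 1) / u.im ^ 2 := by
  have key := digamma_sub_log_add_nat hu m
  have hre : 0 < (u + m).re := by simpa using hm
  have him : (u + m).im = u.im := by simp
  have h1 := norm_digamma_sub_log_le hre (by rw [him]; exact hu)
  rw [him] at h1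
  have hnorm : u.im ≤ ‖u + m‖ := by
    rw [← him]; exact le_trans (le_abs_self _) (Complex.abs_im_le_norm _)
  have h2 : ‖∑ j ∈ Finset.range m, ((u + j)⁻¹ - (Complex.log (u + j + 1) - Complex.log (u + j)))‖
      ≤ m * (1 / u.im ^ 2) := by
    calc _ ≤ ∑ j ∈ Finset.range m, ‖(u + j)⁻¹ - (Complex.log (u + j + 1) - Complex.log (u + j))‖ :=
          norm_sum_le _ _
      _ ≤ ∑ j ∈ Finset.range m, 1 / u.im ^ 2 := by
          refine Finset.sum_le_sum fun j _ ↦ ?_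
          have hj : 0 < (u + j).im := by simpa using hu
          have := norm_log_add_one_sub_log_sub_inv_le hj
          have him' : (u + j).im = u.im := by simp
          rw [him'] at this
          rw [show (u + j)⁻¹ - (Complex.log (u + j + 1) - Complex.log (u + j)) =
            -(Complex.log (u + j + 1) - Complex.log (u + j) - (u + j)⁻¹) by ring, norm_neg]
          exact this
      _ = m * (1 / u.im ^ 2) := by simp
  have h3 : ‖digamma u - Complex.log u‖ ≤ ‖digamma (u + m) - Complex.log (u + m)‖ +
      ‖∑ j ∈ Finset.range m, ((u + j)⁻¹ - (Complex.log (u + j + 1) - Complex.log (u + j)))‖ := by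
    rw [show digamma u - Complex.log u = (digamma (u + m) - Complex.log (u + m)) -
      ∑ j ∈ Finset.range m, ((u + j)⁻¹ - (Complex.log (u + j + 1) - Complex.log (u + j))) by
      rw [key]; ring]
    exact norm_sub_le _ _
  have hpos : 0 < ‖u + ↑m‖ := hu.trans_le hnorm
  have hA : 1 / (2 * ‖u + ↑m‖ ^ 2) ≤ 1 / u.im ^ 2 := by
    rw [div_le_div_iff₀ (mul_pos two_pos (pow_pos hpos 2)) (pow_pos hu 2)]
    nlinarith [mul_le_mul hnorm hnorm hu.le (norm_nonneg _), mul_pos hu hu]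
  have hB : u.im / ‖u + ↑m‖ ^ 2 ≤ 1 / u.im := by
    rw [div_le_div_iff₀ (pow_pos hpos 2) hu]
    nlinarith [mul_le_mul hnorm hnorm hu.le (norm_nonneg _), mul_pos hu hu]
  have hC : Real.pi / (4 * |u.im|) = (Real.pi / 4) / u.im := by
    rw [abs_of_pos hu]; ring
  calc ‖digamma u - Complex.log u‖ ≤ (1 / (2 * ‖u + ↑m‖ ^ 2) + Real.pi / (4 * |u.im|) + u.im / ‖u + ↑m‖ ^ 2)
        + m * (1 / u.im ^ 2) := h3.trans (add_le_add h1 h2)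
    _ ≤ (1 / u.im ^ 2 + (Real.pi / 4) / u.im + 1 / u.im) + m * (1 / u.im ^ 2) := by
        rw [hC]; gcongr
    _ = (Real.pi / 4 + 1) / u.im + (m + 1) / u.im ^ 2 := by ring

/-- `Γ` is holomorphic on the open upper half-plane. [folklore] -/
theorem differentiableOn_Gamma_im_pos : DifferentiableOn ℂ Gamma {w : ℂ | 0 < w.im} :=
  fun w hw ↦ (Complex.differentiableAt_Gamma w fun m h ↦ by
    have : w.im = 0 := by rw [h]; simp
    exact (ne_of_gt (show (0:ℝ) < w.im from hw)) this).differentiableWithinAt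

/-- `ψ = Γ'/Γ` is holomorphic on the open upper half-plane. [folklore] -/
theorem differentiableOn_digamma_im_pos : DifferentiableOn ℂ digamma {w : ℂ | 0 < w.im} := by
  have hopen : IsOpen {w : ℂ | 0 < w.im} := isOpen_lt continuous_const Complex.continuous_im
  have hG := differentiableOn_Gamma_im_pos
  have hG' : DifferentiableOn ℂ (deriv Gamma) {w : ℂ | 0 < w.im} :=
    (hG.analyticOnNhd hopen).deriv.differentiableOn
  have : digamma = fun w ↦ deriv Gamma w / Gamma w := by
    funext w; rw [Complex.digamma_def, logDeriv_apply]
  rw [this]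
  refine hG'.div hG fun w hw ↦ Complex.Gamma_ne_zero fun m h ↦ ?_
  have : w.im = 0 := by rw [h]; simp
  exact (ne_of_gt (show (0:ℝ) < w.im from hw)) this

/-- **`Γ(w) = Γ(w₀)·exp(∫_{[w₀,w]} ψ)`** for `w₀, w` in the open upper half-plane (segment integral of
the logarithmic derivative; `G(τ) = Γ(w₀+τd)e^{-∫_0^τ ψ d}` has zero derivative). [folklore] -/
theorem Gamma_eq_mul_exp_integral_digamma {w₀ w : ℂ} (h₀ : 0 < w₀.im) (h₁ : 0 < w.im) :
    Gamma w = Gamma w₀ *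
      Complex.exp (∫ τ in (0:ℝ)..1, digamma (w₀ + τ * (w - w₀)) * (w - w₀)) := by
  set d : ℂ := w - w₀ with hd
  set seg : ℝ → ℂ := fun τ ↦ w₀ + τ * d with hseg
  have him : ∀ τ ∈ Icc (0:ℝ) 1, 0 < (seg τ).im := by
    intro τ hτ
    simp only [hseg, hd, add_im, mul_im, ofReal_re, sub_im, ofReal_im, zero_mul, add_zero]
    have h1 := mul_nonneg hτ.1 h₁.le
    have h2 := mul_nonneg (sub_nonneg.2 hτ.2) h₀.le
    rcases le_or_gt τ (1/2) with hτ2 | hτ2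
    · nlinarith
    · nlinarith
  have hpole : ∀ τ ∈ Icc (0:ℝ) 1, ∀ m : ℕ, seg τ ≠ -m := fun τ hτ m h ↦ by
    have := congrArg Complex.im h
    simp only [neg_im, natCast_im, neg_zero] at this
    exact (him τ hτ).ne' this
  -- clamped integrand, continuous on all of `ℝ`
  set cl : ℝ → ℝ := fun σ ↦ max 0 (min σ 1) with hcl
  have hcl_mem : ∀ σ, cl σ ∈ Icc (0:ℝ) 1 := fun σ ↦
    ⟨le_max_left _ _, max_le zero_le_one (min_le_right _ _)⟩
  have hcl_id : ∀ σ ∈ Icc (0:ℝ) 1, cl σ = σ := fun σ hσ ↦ by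
    simp only [hcl]; rw [min_eq_left hσ.2, max_eq_right hσ.1]
  have hcl_cont : Continuous cl := by fun_prop
  set f : ℝ → ℂ := fun σ ↦ digamma (seg (cl σ)) * d with hf
  have hf_cont : Continuous f := by
    refine Continuous.mul ?_ continuous_const
    have hsegc : Continuous fun σ ↦ seg (cl σ) := by
      simp only [hseg]; fun_prop
    refine (differentiableOn_digamma_im_pos.continuousOn).comp_continuous hsegc fun σ ↦ ?_
    exact him _ (hcl_mem σ)
  set P : ℝ → ℂ := fun τ ↦ ∫ σ in (0:ℝ)..τ, f σ with hP
  have hP_deriv : ∀ τ, HasDerivAt P (f τ) τ := fun τ ↦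
    intervalIntegral.integral_hasDerivAt_right (hf_cont.intervalIntegrable _ _)
      (hf_cont.stronglyMeasurableAtFilter _ _) hf_cont.continuousAt
  set G : ℝ → ℂ := fun τ ↦ Gamma (seg τ) * Complex.exp (-P τ) with hG
  have hseg_deriv : ∀ τ : ℝ, HasDerivAt seg d τ := fun τ ↦ by
    have h1 : HasDerivAt (fun z : ℂ ↦ w₀ + z * d) d (τ : ℂ) := by
      simpa using ((hasDerivAt_id (τ : ℂ)).mul_const d).const_add w₀
    exact h1.comp_ofReal
  have hG_deriv : ∀ τ ∈ Icc (0:ℝ) 1, HasDerivAt G 0 τ := by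
    intro τ hτ
    have hΓd := Complex.differentiableAt_Gamma _ (hpole τ hτ)
    have hΓ : HasDerivAt (fun τ : ℝ ↦ Gamma (seg τ)) (deriv Gamma (seg τ) * d) τ := by
      have h1 : HasDerivAt (fun z : ℂ ↦ Gamma (w₀ + z * d)) (deriv Gamma (seg τ) * d) (τ : ℂ) := by
        have hi : HasDerivAt (fun z : ℂ ↦ w₀ + z * d) d (τ : ℂ) := by
          simpa using ((hasDerivAt_id (τ : ℂ)).mul_const d).const_add w₀
        exact hΓd.hasDerivAt.comp (τ : ℂ) hi
      exact h1.comp_ofReal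
    have hE : HasDerivAt (fun τ : ℝ ↦ Complex.exp (-P τ)) (Complex.exp (-P τ) * -f τ) τ :=
      (hP_deriv τ).neg.cexp
    have hprod := hΓ.mul hE
    have hdΓ : deriv Gamma (seg τ) = digamma (seg τ) * Gamma (seg τ) := by
      rw [Complex.digamma_def, logDeriv_apply, div_mul_cancel₀ _ (Complex.Gamma_ne_zero (hpole τ hτ))]
    have hfτ : f τ = digamma (seg τ) * d := by simp only [hf, hcl_id τ hτ]
    have hzero : deriv Gamma (seg τ) * d * Complex.exp (-P τ) +
        Gamma (seg τ) * (Complex.exp (-P τ) * -f τ) = 0 := by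
      rw [hdΓ, hfτ]; ring
    rw [hzero] at hprod
    exact hprod
  have hG_cont : ContinuousOn G (Icc 0 1) := fun τ hτ ↦ (hG_deriv τ hτ).continuousAt.continuousWithinAt
  have hconst := constant_of_has_deriv_right_zero hG_cont
    (fun τ hτ ↦ (hG_deriv τ (Ico_subset_Icc_self hτ)).hasDerivWithinAt) 1 ⟨zero_le_one, le_rfl⟩
  -- unpack `G 1 = G 0`
  have hP0 : P 0 = 0 := by simp [hP]
  have hseg0 : seg 0 = w₀ := by simp [hseg]
  have hseg1 : seg 1 = w := by simp [hseg, hd]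
  have hP1 : P 1 = ∫ τ in (0:ℝ)..1, digamma (w₀ + τ * (w - w₀)) * (w - w₀) := by
    simp only [hP]
    refine intervalIntegral.integral_congr fun σ hσ ↦ ?_
    rw [Set.uIcc_of_le zero_le_one] at hσ
    simp only [hf, hseg, hcl_id σ hσ, hd]
  simp only [hG, hseg0, hseg1, hP0, neg_zero, Complex.exp_zero, mul_one] at hconst
  rw [← hP1, ← hconst, mul_assoc, ← Complex.exp_add, neg_add_cancel, Complex.exp_zero, mul_one]


/-- Imaginary parts along a segment with endpoints in the upper half-plane stay positive. [folklore] -/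
theorem im_seg_pos {w₀ d : ℂ} (h₀ : 0 < w₀.im) (h₁ : 0 < (w₀ + d).im) {τ : ℝ} (hτ : τ ∈ Icc (0:ℝ) 1) :
    0 < (w₀ + τ * d).im := by
  simp only [add_im, mul_im, ofReal_re, ofReal_im, zero_mul, add_zero]
  simp only [add_im] at h₁
  have h1 := mul_nonneg hτ.1 h₁.le
  have h2 := mul_nonneg (sub_nonneg.2 hτ.2) h₀.le
  rcases le_or_gt τ (1/2) with hτ2 | hτ2
  · nlinarith
  · nlinarith

/-- **Second-order Taylor bound for `Log` along a short segment**: if the segment `[w₀, w₀+d]` lies in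
the open upper half-plane and `‖d‖ ≤ ‖w₀‖/2`, then `‖Log(w₀+τd) − Log w₀ − τd/w₀‖ ≤ 2‖d‖²/‖w₀‖²`
for every `τ ∈ [0,1]` (mean value inequality for `σ ↦ Log(w₀+σd) − σd/w₀`, whose derivative
`−σd²/(w₀(w₀+σd))` has norm `≤ 2‖d‖²/‖w₀‖²` because `‖w₀+σd‖ ≥ ‖w₀‖/2`). [folklore] -/
theorem norm_log_seg_sub_le {w₀ d : ℂ} (h₀ : 0 < w₀.im) (h₁ : 0 < (w₀ + d).im)
    (hd : ‖d‖ ≤ ‖w₀‖ / 2) {τ : ℝ} (hτ : τ ∈ Icc (0:ℝ) 1) :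
    ‖Complex.log (w₀ + τ * d) - Complex.log w₀ - τ * d / w₀‖ ≤ 2 * ‖d‖ ^ 2 / ‖w₀‖ ^ 2 := by
  have hw₀ : w₀ ≠ 0 := fun h ↦ by simp [h] at h₀
  have hw₀n : 0 < ‖w₀‖ := norm_pos_iff.2 hw₀
  have hslit : ∀ σ ∈ Icc (0:ℝ) 1, w₀ + σ * d ∈ slitPlane := fun σ hσ ↦ by
    rw [Complex.mem_slitPlane_iff]; exact Or.inr (im_seg_pos h₀ h₁ hσ).ne'
  have hlow : ∀ σ ∈ Icc (0:ℝ) 1, ‖w₀‖ / 2 ≤ ‖w₀ + σ * d‖ := fun σ hσ ↦ by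
    have h1 : ‖(σ : ℂ) * d‖ ≤ ‖w₀‖ / 2 := by
      rw [norm_mul, Complex.norm_real, Real.norm_eq_abs, abs_of_nonneg hσ.1]
      calc σ * ‖d‖ ≤ 1 * ‖d‖ := by gcongr; exact hσ.2
        _ ≤ ‖w₀‖ / 2 := by rw [one_mul]; exact hd
    have h2 := norm_sub_norm_le w₀ (-(σ * d))
    rw [sub_neg_eq_add, norm_neg] at h2
    linarith
  set φ : ℝ → ℂ := fun σ ↦ Complex.log (w₀ + σ * d) - σ * d / w₀ with hφ
  set φ' : ℝ → ℂ := fun σ ↦ d / (w₀ + σ * d) - d / w₀ with hφ'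
  have hderiv : ∀ σ ∈ Icc (0:ℝ) 1, HasDerivWithinAt φ (φ' σ) (Icc 0 1) σ := by
    intro σ hσ
    have hf : HasDerivAt (fun t : ℝ ↦ w₀ + t * d) d σ := by
      have h1 : HasDerivAt (fun z : ℂ ↦ w₀ + z * d) d (σ : ℂ) := by
        simpa using ((hasDerivAt_id (σ : ℂ)).mul_const d).const_add w₀
      exact h1.comp_ofReal
    have h1 : HasDerivAt (fun t : ℝ ↦ Complex.log (w₀ + t * d)) (d / (w₀ + σ * d)) σ :=
      hf.clog_real (hslit σ hσ)
    have h2 : HasDerivAt (fun t : ℝ ↦ (t : ℂ) * d / w₀) (d / w₀) σ := by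
      have h1 : HasDerivAt (fun z : ℂ ↦ z * d / w₀) (d / w₀) (σ : ℂ) := by
        simpa using ((hasDerivAt_id (σ : ℂ)).mul_const d).div_const w₀
      exact h1.comp_ofReal
    exact (h1.sub h2).hasDerivWithinAt
  have hbound : ∀ σ ∈ Ico (0:ℝ) 1, ‖φ' σ‖ ≤ 2 * ‖d‖ ^ 2 / ‖w₀‖ ^ 2 := by
    intro σ hσ
    have hσ' : σ ∈ Icc (0:ℝ) 1 := Ico_subset_Icc_self hσ
    have hne : w₀ + σ * d ≠ 0 := fun h ↦ by
      have := hlow σ hσ'; rw [h, norm_zero] at this; linarith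
    have : φ' σ = -(σ * d ^ 2) / (w₀ * (w₀ + σ * d)) := by
      simp only [hφ']
      rw [div_sub_div _ _ hne hw₀]
      congr 1 <;> ring
    rw [this, norm_div, norm_neg, norm_mul, norm_mul, norm_pow, Complex.norm_real, Real.norm_eq_abs,
      abs_of_nonneg hσ.1]
    have hl := hlow σ hσ'
    rw [div_le_div_iff₀ (mul_pos hw₀n (by linarith)) (by positivity)]
    have hσ1 : σ ≤ 1 := hσ'.2
    have hdn : 0 ≤ ‖d‖ ^ 2 := sq_nonneg _
    calc σ * ‖d‖ ^ 2 * ‖w₀‖ ^ 2 ≤ 1 * ‖d‖ ^ 2 * ‖w₀‖ ^ 2 := by gcongr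
      _ = ‖d‖ ^ 2 * (‖w₀‖ * (2 * (‖w₀‖ / 2))) := by ring
      _ ≤ ‖d‖ ^ 2 * (‖w₀‖ * (2 * ‖w₀ + ↑σ * d‖)) := by gcongr
      _ = 2 * ‖d‖ ^ 2 * (‖w₀‖ * ‖w₀ + ↑σ * d‖) := by ring
  have hmv := norm_image_sub_le_of_norm_deriv_le_segment' hderiv hbound τ hτ
  have hφ0 : φ 0 = Complex.log w₀ := by simp [hφ]
  rw [hφ0] at hmv
  simp only [hφ, sub_zero] at hmv
  calc ‖Complex.log (w₀ + τ * d) - Complex.log w₀ - τ * d / w₀‖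
      = ‖Complex.log (w₀ + τ * d) - τ * d / w₀ - Complex.log w₀‖ := by ring_nf
    _ ≤ 2 * ‖d‖ ^ 2 / ‖w₀‖ ^ 2 * τ := hmv
    _ ≤ 2 * ‖d‖ ^ 2 / ‖w₀‖ ^ 2 * 1 := by gcongr; exact hτ.2
    _ = _ := mul_one _

/-- **The segment integral of `ψ` to second order** (core of [Dobner2021, Lemma 5] for one `Γ`
factor): if `[w₀, w₀+d]` lies in the upper half-plane, `‖d‖ ≤ ‖w₀‖/2`, and `‖ψ − Log‖ ≤ ε` on the
segment, then `∫_0^1 ψ(w₀+τd) d dτ = Log(w₀) d + d²/(2w₀) + E` with `‖E‖ ≤ ε‖d‖ + 2‖d‖³/‖w₀‖²`.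
[folklore] -/
theorem norm_integral_digamma_seg_sub_le {w₀ d : ℂ} {ε : ℝ} (h₀ : 0 < w₀.im) (h₁ : 0 < (w₀ + d).im)
    (hd : ‖d‖ ≤ ‖w₀‖ / 2)
    (hψ : ∀ τ ∈ Icc (0:ℝ) 1, ‖digamma (w₀ + τ * d) - Complex.log (w₀ + τ * d)‖ ≤ ε) :
    ‖(∫ τ in (0:ℝ)..1, digamma (w₀ + τ * d) * d) - (Complex.log w₀ * d + d ^ 2 / (2 * w₀))‖
      ≤ ε * ‖d‖ + 2 * ‖d‖ ^ 3 / ‖w₀‖ ^ 2 := by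
  have hw₀ : w₀ ≠ 0 := fun h ↦ by simp [h] at h₀
  -- continuity of the pieces on `[0,1]`
  have hsegc : Continuous fun τ : ℝ ↦ w₀ + τ * d := by fun_prop
  have hψc : ContinuousOn (fun τ : ℝ ↦ digamma (w₀ + τ * d) * d) (Icc 0 1) := by
    refine ContinuousOn.mul ?_ continuousOn_const
    exact differentiableOn_digamma_im_pos.continuousOn.comp hsegc.continuousOn
      fun τ hτ ↦ im_seg_pos h₀ h₁ hτ
  have hLc : ContinuousOn (fun τ : ℝ ↦ Complex.log (w₀ + τ * d)) (Icc 0 1) := by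
    intro τ hτ
    refine ContinuousAt.continuousWithinAt ?_
    refine ContinuousAt.comp (g := Complex.log) ?_ hsegc.continuousAt
    refine continuousAt_clog ?_
    rw [Complex.mem_slitPlane_iff]; exact Or.inr (im_seg_pos h₀ h₁ hτ).ne'
  have hmainc : Continuous fun τ : ℝ ↦ (Complex.log w₀ + τ * d / w₀) * d := by fun_prop
  -- the main term integrates exactly
  have hmain : ∫ τ in (0:ℝ)..1, (Complex.log w₀ + τ * d / w₀) * d =
      Complex.log w₀ * d + d ^ 2 / (2 * w₀) := by
    have h1 : ∫ τ in (0:ℝ)..1, (Complex.log w₀ + τ * d / w₀) * d =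
        ∫ τ in (0:ℝ)..1, (Complex.log w₀ * d + (τ : ℂ) * (d ^ 2 / w₀)) := by
      refine intervalIntegral.integral_congr fun τ _ ↦ ?_; ring
    rw [h1, intervalIntegral.integral_add ((by fun_prop : Continuous fun τ : ℝ ↦
        Complex.log w₀ * d).intervalIntegrable _ _) ((by fun_prop : Continuous fun τ : ℝ ↦
        (τ : ℂ) * (d ^ 2 / w₀)).intervalIntegrable _ _),
      intervalIntegral.integral_const, intervalIntegral.integral_mul_const,
      intervalIntegral.integral_ofReal, integral_id]
    simp; ring
  -- remainder
  set R : ℝ → ℂ := fun τ ↦ digamma (w₀ + τ * d) * d - (Complex.log w₀ + τ * d / w₀) * d with hR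
  have hRb : ∀ τ ∈ Set.uIoc (0:ℝ) 1, ‖R τ‖ ≤ ε * ‖d‖ + 2 * ‖d‖ ^ 3 / ‖w₀‖ ^ 2 := by
    intro τ hτ
    rw [Set.uIoc_of_le zero_le_one] at hτ
    have hτ' : τ ∈ Icc (0:ℝ) 1 := ⟨hτ.1.le, hτ.2⟩
    have e1 := hψ τ hτ'
    have e2 := norm_log_seg_sub_le h₀ h₁ hd hτ'
    have : R τ = (digamma (w₀ + τ * d) - Complex.log (w₀ + τ * d)) * d +
        (Complex.log (w₀ + τ * d) - Complex.log w₀ - τ * d / w₀) * d := by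
      simp only [hR]; ring
    rw [this]
    refine (norm_add_le _ _).trans ?_
    rw [norm_mul, norm_mul]
    have hdn := norm_nonneg d
    calc _ ≤ ε * ‖d‖ + 2 * ‖d‖ ^ 2 / ‖w₀‖ ^ 2 * ‖d‖ := by gcongr
      _ = _ := by ring
  have hsplit : (∫ τ in (0:ℝ)..1, digamma (w₀ + τ * d) * d) - (Complex.log w₀ * d + d ^ 2 / (2 * w₀))
      = ∫ τ in (0:ℝ)..1, R τ := by
    rw [← hmain, ← intervalIntegral.integral_sub]
    · exact (hψc.mono (by rw [Set.uIcc_of_le zero_le_one])).intervalIntegrable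
    · exact hmainc.intervalIntegrable _ _
  rw [hsplit]
  calc ‖∫ τ in (0:ℝ)..1, R τ‖ ≤ (ε * ‖d‖ + 2 * ‖d‖ ^ 3 / ‖w₀‖ ^ 2) * |1 - 0| :=
        intervalIntegral.norm_integral_le_of_norm_le_const hRb
    _ = _ := by simp

/-! ## The second-order expansion of `Γ(w₀+d)/Γ(w₀)` -/

/-- **`Γ(w₀+d) = Γ(w₀)·exp(Log(w₀)d + d²/(2w₀) + E)`, `‖E‖ ≤ ε‖d‖ + 2‖d‖³/‖w₀‖²**, whenever
`[w₀, w₀+d]` lies in the open upper half-plane, `‖d‖ ≤ ‖w₀‖/2` and `‖ψ − Log‖ ≤ ε` on the segment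
(cf. [Dobner2021, Lemma 5], one `Γ` factor; proved here via `ψ`). [cite: Dobner2021, Lemma 5] -/
theorem Gamma_eq_mul_exp_taylor {w₀ d : ℂ} {ε : ℝ} (h₀ : 0 < w₀.im) (h₁ : 0 < (w₀ + d).im)
    (hd : ‖d‖ ≤ ‖w₀‖ / 2)
    (hψ : ∀ τ ∈ Icc (0:ℝ) 1, ‖digamma (w₀ + τ * d) - Complex.log (w₀ + τ * d)‖ ≤ ε) :
    ∃ E : ℂ, ‖E‖ ≤ ε * ‖d‖ + 2 * ‖d‖ ^ 3 / ‖w₀‖ ^ 2 ∧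
      Gamma (w₀ + d) = Gamma w₀ * Complex.exp (Complex.log w₀ * d + d ^ 2 / (2 * w₀) + E) := by
  refine ⟨(∫ τ in (0:ℝ)..1, digamma (w₀ + τ * d) * d) - (Complex.log w₀ * d + d ^ 2 / (2 * w₀)),
    norm_integral_digamma_seg_sub_le h₀ h₁ hd hψ, ?_⟩
  rw [add_sub_cancel, Gamma_eq_mul_exp_integral_digamma h₀ h₁]
  simp only [add_sub_cancel_left]

/-- The hypothesis `‖ψ − Log‖ ≤ ε` of `Gamma_eq_mul_exp_taylor` along a segment with
`Im ≥ b > 0` and `Re > −m` at both endpoints: `ε = (π/4+1)/b + (m+1)/b²` works. [folklore] -/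
theorem norm_digamma_sub_log_le_seg {w₀ d : ℂ} {b : ℝ} {m : ℕ} (hb : 0 < b) (h₀ : b ≤ w₀.im)
    (h₁ : b ≤ (w₀ + d).im) (hr₀ : 0 < w₀.re + m) (hr₁ : 0 < (w₀ + d).re + m)
    {τ : ℝ} (hτ : τ ∈ Icc (0:ℝ) 1) :
    ‖digamma (w₀ + τ * d) - Complex.log (w₀ + τ * d)‖ ≤ (Real.pi / 4 + 1) / b + (m + 1) / b ^ 2 := by
  set u : ℂ := w₀ + τ * d with hu
  have him : b ≤ u.im := by
    simp only [hu, add_im, mul_im, ofReal_re, ofReal_im, zero_mul, add_zero]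
    simp only [add_im] at h₁
    have h1 := mul_le_mul_of_nonneg_left (show b - w₀.im ≤ d.im by linarith) hτ.1
    nlinarith [hτ.1, hτ.2, mul_nonneg (sub_nonneg.2 hτ.2) (sub_nonneg.2 h₀)]
  have hre : 0 < u.re + m := by
    simp only [hu, add_re, mul_re, ofReal_re, ofReal_im, zero_mul, sub_zero]
    simp only [add_re] at hr₁
    have h1 := mul_nonneg hτ.1 hr₁.le
    have h2 := mul_nonneg (sub_nonneg.2 hτ.2) hr₀.le
    rcases le_or_gt τ (1/2) with hτ2 | hτ2
    · nlinarith
    · nlinarith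
  have hupos : 0 < u.im := hb.trans_le him
  have h := norm_digamma_sub_log_le_of_im_pos hupos m hre
  refine h.trans (add_le_add ?_ ?_)
  · exact div_le_div_of_nonneg_left (by positivity) hb him
  · exact div_le_div_of_nonneg_left (by positivity) (pow_pos hb 2)
      (pow_le_pow_left₀ hb.le him 2)

end Literature.Analysis.SpecialFunctions.Complex
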